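import Summits.QuantumFields.YangMills.Theorems.CovarianceBound.Negative.SU2Angle

/-!
# SU(2): the rotation angle as a conjugation-invariant subadditive class function; the diagonal subgroup
(helper file for the frozen-coupling analysis of crux `CrossoverCertificate`, stmt-QuantumFields-16125)

We reuse the rotation half-angle `ang V = arccos (Re V₀₀)` of
`Theorems/CovarianceBound/Negative/SU2Angle.lean` (subadditivity `ang_mul_le`, `ang_one`, `cos_ang`) and add
what the lattice Stokes bound and the twisted boundary condition of the frozen-coupling analysis consume:

* `su2_trace_re` : `Re tr U = 2 Re U₀₀`, hence `Re tr U = 2 cos (ang U)` (`su2_trace_re_eq_two_mul_cos_ang`) and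
  `2 - Re tr U = 2 (1 - cos (ang U))` (`two_sub_trace_re_eq`);
* `ang_conj` : `ang (V U V⁻¹) = ang U` (cyclicity of the trace), `ang_mul_le_add` : `ang (U V) ≤ ang U + ang V`;
* `exists_su2_diagonal_subgroup` : a one-parameter subgroup `D t = diag (e^{it}, e^{-it})` with
  `Re tr (D t) = 2 cos t` and `ang (D t) = t` for `t ∈ [0, π]` (stated as an existence theorem; no definition
  is introduced).

Elementary; folklore.
-/

noncomputable section

namespace Summit.QuantumFields.YangMills.Theorems.CrossoverCertificate.Negative

open Matrix Complex Real
open Literature.MathematicalPhysics.QuantumLattice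
open Summit.QuantumFields.YangMills.Theorems.CovarianceBound.Negative

/-! ### The real part of the trace and the angle -/

/-- For `U ∈ SU(2)`: `Re tr U = 2 Re (U 0 0)` (the second diagonal entry is the conjugate of the first,
tree lemma `su2_apply_11`). [folklore] -/
theorem su2_trace_re (U : Matrix.specialUnitaryGroup (Fin 2) ℂ) :
    ((U : Matrix (Fin 2) (Fin 2) ℂ).trace).re = 2 * ((U : Matrix (Fin 2) (Fin 2) ℂ) 0 0).re := by
  rw [Matrix.trace_fin_two, su2_apply_11, Complex.add_re, Complex.conj_re, two_mul]

/-- For `U ∈ SU(2)`: `Re tr U = 2 cos (ang U)`. [folklore] -/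
theorem su2_trace_re_eq_two_mul_cos_ang (U : Matrix.specialUnitaryGroup (Fin 2) ℂ) :
    ((U : Matrix (Fin 2) (Fin 2) ℂ).trace).re = 2 * Real.cos (ang U) := by
  rw [su2_trace_re, cos_ang]

/-- For `U ∈ SU(2)`: the Wilson plaquette weight `2 - Re tr U` equals `2 (1 - cos (ang U))`. [folklore] -/
theorem two_sub_trace_re_eq (U : Matrix.specialUnitaryGroup (Fin 2) ℂ) :
    2 - ((U : Matrix (Fin 2) (Fin 2) ℂ).trace).re = 2 * (1 - Real.cos (ang U)) := by
  rw [su2_trace_re_eq_two_mul_cos_ang]; ring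

/-- For `U ∈ SU(2)`: `0 ≤ 2 - Re tr U`. [folklore] -/
theorem two_sub_trace_re_nonneg (U : Matrix.specialUnitaryGroup (Fin 2) ℂ) :
    0 ≤ 2 - ((U : Matrix (Fin 2) (Fin 2) ℂ).trace).re := by
  rw [two_sub_trace_re_eq]
  have := Real.cos_le_one (ang U)
  nlinarith

/-- The angle in terms of the trace: `ang U = arccos (Re tr U / 2)`. [folklore] -/
theorem ang_eq_arccos_half_trace_re (U : Matrix.specialUnitaryGroup (Fin 2) ℂ) :
    ang U = Real.arccos (((U : Matrix (Fin 2) (Fin 2) ℂ).trace).re / 2) := by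
  rw [ang, su2_trace_re, mul_div_cancel_left₀ _ (two_ne_zero' ℝ)]

/-- The underlying matrix of `U⁻¹` is `star U`. [folklore] -/
theorem su2_coe_inv (U : Matrix.specialUnitaryGroup (Fin 2) ℂ) :
    ((U⁻¹ : Matrix.specialUnitaryGroup (Fin 2) ℂ) : Matrix (Fin 2) (Fin 2) ℂ) = star (U : Matrix (Fin 2) (Fin 2) ℂ) :=
  rfl

/-- `Re tr` is a class function on `SU(2)`: `Re tr (V U V⁻¹) = Re tr U`. [folklore] -/
theorem su2_trace_re_conj (U V : Matrix.specialUnitaryGroup (Fin 2) ℂ) :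
    (((V * U * V⁻¹ : Matrix.specialUnitaryGroup (Fin 2) ℂ) : Matrix (Fin 2) (Fin 2) ℂ).trace).re =
      ((U : Matrix (Fin 2) (Fin 2) ℂ).trace).re := by
  rw [Submonoid.coe_mul, Submonoid.coe_mul, su2_coe_inv, Matrix.trace_mul_cycle,
    Matrix.mem_unitaryGroup_iff'.1 (Matrix.mem_specialUnitaryGroup_iff.1 V.prop).1, Matrix.one_mul]

/-- **Conjugation invariance of the angle**: `ang (V U V⁻¹) = ang U`. [folklore] -/
theorem ang_conj : ∀ U V : Matrix.specialUnitaryGroup (Fin 2) ℂ, Summit.QuantumFields.YangMills.Theorems.CovarianceBound.Negative.ang (V * U * V⁻¹) = Summit.QuantumFields.YangMills.Theorems.CovarianceBound.Negative.ang U := by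
  intro U V
  rw [ang_eq_arccos_half_trace_re, ang_eq_arccos_half_trace_re, su2_trace_re_conj]

/-- **Subadditivity of the angle**: `ang (U V) ≤ ang U + ang V`. [folklore] -/
theorem ang_mul_le_add (U V : Matrix.specialUnitaryGroup (Fin 2) ℂ) : ang (U * V) ≤ ang U + ang V :=
  (ang_mul_le U V).trans (min_le_right _ _)

/-- `ang 1 ≤ 0` (in fact `= 0`; the form consumed by the lattice Stokes bound). [folklore] -/
theorem ang_one_le : ang (1 : Matrix.specialUnitaryGroup (Fin 2) ℂ) ≤ 0 :=
  ang_one.le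

/-! ### The diagonal one-parameter subgroup -/

/-- `diag (e^{it}, e^{-it}) ∈ SU(2)`. [folklore] -/
theorem exp_diag_mem_specialUnitaryGroup (t : ℝ) :
    !![Complex.exp (t * Complex.I), 0; 0, Complex.exp (-(t * Complex.I))] ∈ Matrix.specialUnitaryGroup (Fin 2) ℂ := by
  have h1 : Complex.exp (t * Complex.I) * Complex.exp (-(t * Complex.I)) = 1 := by
    rw [← Complex.exp_add, add_neg_cancel, Complex.exp_zero]
  have h2 : Complex.exp (-(t * Complex.I)) * Complex.exp (t * Complex.I) = 1 := by
    rw [mul_comm, h1]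
  have hs : starRingEnd ℂ (Complex.exp (t * Complex.I)) = Complex.exp (-(t * Complex.I)) := by
    rw [← Complex.exp_conj, map_mul, Complex.conj_ofReal, Complex.conj_I, mul_neg]
  have hs' : starRingEnd ℂ (Complex.exp (-(t * Complex.I))) = Complex.exp (t * Complex.I) := by
    rw [← hs, Complex.conj_conj]
  rw [Matrix.mem_specialUnitaryGroup_iff, Matrix.mem_unitaryGroup_iff]
  refine ⟨?_, ?_⟩
  · ext i j
    fin_cases i <;> fin_cases j <;>
      simp [Matrix.mul_apply, Fin.sum_univ_two, Matrix.star_apply, hs, hs', h1, h2]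
  · rw [Matrix.det_fin_two_of, h1, mul_zero, sub_zero]

/-- A one-parameter group `D : ℝ → SU(2)` satisfies `D (-t) = (D t)⁻¹`. [folklore] -/
theorem oneParam_neg_eq_inv (D : ℝ → Matrix.specialUnitaryGroup (Fin 2) ℂ)
    (hadd : ∀ s t : ℝ, D (s + t) = D s * D t) (h0 : D 0 = 1) (t : ℝ) : D (-t) = (D t)⁻¹ :=
  eq_inv_of_mul_eq_one_left (by rw [← hadd, neg_add_cancel, h0])

/-- A one-parameter group `D : ℝ → SU(2)` satisfies `D s * (D t)⁻¹ = D (s - t)`. [folklore] -/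
theorem oneParam_mul_inv (D : ℝ → Matrix.specialUnitaryGroup (Fin 2) ℂ)
    (hadd : ∀ s t : ℝ, D (s + t) = D s * D t) (h0 : D 0 = 1) (s t : ℝ) : D s * (D t)⁻¹ = D (s - t) := by
  rw [← oneParam_neg_eq_inv D hadd h0, ← hadd, sub_eq_add_neg]

/-- **The diagonal one-parameter subgroup of `SU(2)`**: a group homomorphism `D : ℝ → SU(2)`,
`D t = diag (e^{it}, e^{-it})`, with `Re tr (D t) = 2 cos t` and `ang (D t) = t` for `t ∈ [0, π]`. Stated as an
existence theorem (no definition is introduced). [folklore] -/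
theorem exists_su2_diagonal_subgroup :
    ∃ D : ℝ → Matrix.specialUnitaryGroup (Fin 2) ℂ,
      (∀ s t : ℝ, D (s + t) = D s * D t) ∧ D 0 = 1 ∧
      (∀ t : ℝ, (((D t : Matrix.specialUnitaryGroup (Fin 2) ℂ) : Matrix (Fin 2) (Fin 2) ℂ).trace).re =
        2 * Real.cos t) ∧
      (∀ t : ℝ, 0 ≤ t → t ≤ π → ang (D t) = t) := by
  have htr : ∀ t : ℝ,
      (Matrix.trace !![Complex.exp (t * Complex.I), 0; 0, Complex.exp (-(t * Complex.I))]).re = 2 * Real.cos t := by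
    intro t
    rw [Matrix.trace_fin_two_of, Complex.add_re, Complex.exp_ofReal_mul_I_re,
      show -((t : ℂ) * Complex.I) = ((-t : ℝ) : ℂ) * Complex.I by push_cast; ring, Complex.exp_ofReal_mul_I_re,
      Real.cos_neg, two_mul]
  refine ⟨fun t => ⟨_, exp_diag_mem_specialUnitaryGroup t⟩, fun s t => Subtype.ext ?_, Subtype.ext ?_,
    fun t => htr t, fun t ht0 htπ => ?_⟩
  · rw [Submonoid.coe_mul, Matrix.mul_fin_two]
    simp only [mul_zero, zero_mul, add_zero, zero_add, ← Complex.exp_add, Complex.ofReal_add, add_mul, neg_add]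
  · rw [OneMemClass.coe_one, Matrix.one_fin_two]
    simp
  · rw [ang_eq_arccos_half_trace_re]
    show Real.arccos ((Matrix.trace !![Complex.exp (t * Complex.I), 0; 0, Complex.exp (-(t * Complex.I))]).re / 2) = t
    rw [htr t, mul_div_cancel_left₀ _ (two_ne_zero' ℝ), Real.arccos_cos ht0 htπ]

end Summit.QuantumFields.YangMills.Theorems.CrossoverCertificate.Negative

end
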